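import Mathlib.LinearAlgebra.Matrix.Adjugate
import Mathlib.Algebra.Polynomial.Degree.TrailingDegree
import Literature.Computability.AlgebraicComplexity.PencilTriangularization
import Literature.Computability.AlgebraicComplexity.DegenerationSpectralMonotone
import HarnessLib

/-!
# Every `3 × 3 × 2` tensor is a degeneration of `⟨3⟩` (maximal border rank of format `(3,3,2)` is `3`)

Topic `Literature/Computability/AlgebraicComplexity`. Over an algebraically closed field `F`, every
2-slice tensor `t ∈ F³ ⊗ F³ ⊗ F²` (a pencil of `3 × 3` matrices `M₁, M₂`) satisfies `t ⊴ ⟨3⟩` in the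
algebraic sense of `DegenerationSpectralMonotone.lean` (`AlgDegeneratesTo`, BCS (15.19)), i.e. its
border rank over `F[ε]` is at most `3`: Bürgisser–Clausen–Shokrollahi 1997, Example (20.5)(2)
("`R̲(n,n,2) = n`", here `n = 3`; with Thm. (20.3), every tensor of a format has border rank at most the
typical rank). The book argues by genericity + Zariski closure; here the degeneration is EXPLICIT:

1. (`PencilTriangularization.lean`) `M_k = P T_k Q` with `T₁, T₂` upper triangular;
2. (`MatrixPencil.exists_eigenmatrix`, any commutative ring) for upper triangular `A, B` put
   `T = adj(A) B` (upper triangular, diagonal `μ_i`), and let `V` be the explicit polynomial matrix of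
   eigenvectors of `T` (`T V = V diag(μ)`); then
   `∑ᵢ (A V eᵢ) ⊗ (adj V)ᵢ ⊗ (det A, μᵢ) = det A · det V · (A, B)` — the eigen-decomposition of a
   regular upper triangular pencil with all denominators cleared;
3. (`MatrixPencil.exists_isApproxDecomposition_of_blockTriangular`) apply 2. over `F[ε]` to the
   perturbed pencil `(T₁ + ε I, T₂ + ε diag(c))` with three distinct scalars `cᵢ`: the factor
   `D = det A · det V` is a NONZERO polynomial, `D = ε^v (q₀ + …)` with `q₀ ≠ 0`, so reading off the
   coefficient of `ε^v` gives an approximate decomposition of order `v` with three triads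
   (`isApproxDecomposition_of_sum_eq_mul`);
4. transport back along `P, Q` (`IsApproxRestriction.eq_sum_comp`).

## Contents

* `MatrixPencil.isApproxDecomposition_of_sum_eq_mul` — lowest-order extraction.
* `MatrixPencil.exists_eigenmatrix` — the cleared eigen-decomposition identity (step 2).
* `MatrixPencil.exists_isApproxDecomposition_of_blockTriangular` — step 3.
* `MatrixPencil.algDegeneratesTo_unitTensor_pencil` — **`(M₁, M₂) ⊴ ⟨3⟩`** for all `M₁, M₂ ∈ F^{3×3}`.

Theorems only (no definitions, no named facts). Used by `AlmanLi2026ThreeByThreeProofs.lean`.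

## References

* P. Bürgisser, M. Clausen, M. A. Shokrollahi, *Algebraic Complexity Theory*, Springer 1997,
  Example (20.5)(2), Thm. (20.3), (15.19). [BurgisserClausenShokrollahi1997]
-/

noncomputable section

open scoped BigOperators Polynomial
open Matrix Polynomial

namespace Literature.Computability.AlgebraicComplexity

namespace MatrixPencil

/-! ## The cleared eigen-decomposition of an upper triangular pencil (any commutative ring) -/

section UT

variable {R : Type*} [CommRing R]

/-- For upper triangular `A, B ∈ R^{3×3}` the matrix `T = adj(A) B` is upper triangular with diagonal
`(A₁₁A₂₂B₀₀, A₀₀A₂₂B₁₁, A₀₀A₁₁B₂₂)`. [folklore] -/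
theorem adjugate_mul_of_blockTriangular {A B : Matrix (Fin 3) (Fin 3) R} (hA : A.BlockTriangular id)
    (hB : B.BlockTriangular id) :
    ((A.adjugate * B) 1 0 = 0 ∧ (A.adjugate * B) 2 0 = 0 ∧ (A.adjugate * B) 2 1 = 0) ∧
      (A.adjugate * B) 0 0 = A 1 1 * A 2 2 * B 0 0 ∧ (A.adjugate * B) 1 1 = A 0 0 * A 2 2 * B 1 1 ∧
        (A.adjugate * B) 2 2 = A 0 0 * A 1 1 * B 2 2 := by
  obtain ⟨a10, a20, a21⟩ := (blockTriangular_iff₃ A).1 hA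
  obtain ⟨b10, b20, b21⟩ := (blockTriangular_iff₃ B).1 hB
  refine ⟨⟨?_, ?_, ?_⟩, ?_, ?_, ?_⟩ <;>
    simp [Matrix.mul_apply, Fin.sum_univ_three, Matrix.adjugate_fin_three, a10, a20, a21, b10, b20,
      b21]

/-- **The cleared eigen-decomposition of an upper triangular `3 × 3` pencil.** For upper triangular
`A, B` over a commutative ring let `T = adj(A) B` (diagonal `μ`). There is a matrix `V` — the
explicit matrix `[[1, T₀₁, T₀₁T₁₂ + T₀₂(T₂₂ - T₁₁)], [0, T₁₁ - T₀₀, T₁₂(T₂₂ - T₀₀)],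
[0, 0, (T₂₂ - T₀₀)(T₂₂ - T₁₁)]]` of eigenvectors of `T`, `T V = V diag(μ)` — with
`det V = (μ₁ - μ₀)(μ₂ - μ₀)(μ₂ - μ₁)` and
`∑ᵢ (A V)_{ai} (adj V)_{ib} (det A, μᵢ) = det A · det V · (A_{ab}, B_{ab})`:
over a field and for a regular pencil with distinct eigenvalues this is the rank-`3` decomposition
`s A + t B = ∑ᵢ (s + μᵢ' t) xᵢ ⊗ yᵢ` (BCS Example (20.5)(2): `X I + Y D`) multiplied through by its
denominators. [cite: BurgisserClausenShokrollahi1997, Example (20.5)(2)] -/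
theorem exists_eigenmatrix {A B : Matrix (Fin 3) (Fin 3) R} (hA : A.BlockTriangular id)
    (hB : B.BlockTriangular id) :
    ∃ V : Matrix (Fin 3) (Fin 3) R,
      V.det = ((A.adjugate * B) 1 1 - (A.adjugate * B) 0 0) *
        (((A.adjugate * B) 2 2 - (A.adjugate * B) 0 0) * ((A.adjugate * B) 2 2 - (A.adjugate * B) 1 1)) ∧
      (∀ a b, ∑ i, (A * V) a i * V.adjugate i b * A.det = A.det * V.det * A a b) ∧
      (∀ a b, ∑ i, (A * V) a i * V.adjugate i b * (A.adjugate * B) i i = A.det * V.det * B a b) := by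
  obtain ⟨T, hT⟩ : ∃ T, T = A.adjugate * B := ⟨_, rfl⟩
  obtain ⟨⟨h10, h20, h21⟩, -⟩ := adjugate_mul_of_blockTriangular hA hB
  rw [← hT] at h10 h20 h21
  obtain ⟨V, hV⟩ : ∃ V : Matrix (Fin 3) (Fin 3) R,
      V = !![1, T 0 1, T 0 1 * T 1 2 + T 0 2 * (T 2 2 - T 1 1);
            0, T 1 1 - T 0 0, T 1 2 * (T 2 2 - T 0 0);
            0, 0, (T 2 2 - T 0 0) * (T 2 2 - T 1 1)] := ⟨_, rfl⟩
  have hTV : T * V = V * diagonal (fun i => T i i) := by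
    ext i j
    fin_cases i <;> fin_cases j <;>
      simp [hV, Matrix.mul_apply, Fin.sum_univ_three, Matrix.diagonal, h10, h20, h21] <;> ring
  rw [← hT]
  refine ⟨V, by simp [hV, Matrix.det_fin_three], fun a b => ?_, fun a b => ?_⟩
  · have h1 : ∑ i, (A * V) a i * V.adjugate i b * A.det = A.det * ((A * V) * V.adjugate) a b := by
      rw [Matrix.mul_apply, Finset.mul_sum]
      exact Finset.sum_congr rfl fun i _ => by ring
    rw [h1, Matrix.mul_assoc, Matrix.mul_adjugate, Matrix.mul_smul, Matrix.mul_one, Matrix.smul_apply,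
      smul_eq_mul]
    ring
  · have h1 : ∑ i, (A * V) a i * V.adjugate i b * T i i =
        (A * (V * diagonal (fun i => T i i)) * V.adjugate) a b := by
      rw [← Matrix.mul_assoc, Matrix.mul_apply]
      refine Finset.sum_congr rfl fun i _ => ?_
      rw [Matrix.mul_diagonal]
      ring
    rw [h1, ← hTV, Matrix.mul_assoc, Matrix.mul_assoc, Matrix.mul_adjugate, Matrix.mul_smul,
      Matrix.mul_one, Matrix.mul_smul, Matrix.smul_apply, smul_eq_mul, hT, ← Matrix.mul_assoc,
      Matrix.mul_adjugate, Matrix.smul_mul, Matrix.one_mul, Matrix.smul_apply, smul_eq_mul]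
    ring

end UT

/-! ## The polynomial layer: lowest-order extraction and the perturbed pencil -/

section PolyLayer

variable {F : Type*} [Field F]
variable {ι κ μ : Type*}

/-- **Lowest-order extraction**: if `∑ᵢ uᵢ ⊗ vᵢ ⊗ wᵢ = D · (t + ε r)` coefficientwise with a NONZERO
polynomial `D = ε^v (q₀ + …)`, `q₀ ≠ 0`, then dividing the first leg by `q₀` gives an approximate
decomposition of `t` of order `v = ord D` (Bläser 2013, Def. 6.1, with the units of `F[[ε]]`
discarded). [folklore] -/
theorem isApproxDecomposition_of_sum_eq_mul {t r : ι → κ → μ → F} {D : F[X]} (hD : D ≠ 0) {n : ℕ}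
    {u : Fin n → ι → F[X]} {v : Fin n → κ → F[X]} {w : Fin n → μ → F[X]}
    (h : ∀ a b c, ∑ i, u i a * v i b * w i c = D * (C (t a b c) + X * C (r a b c))) :
    IsApproxDecomposition D.natTrailingDegree t (fun i a => C (D.trailingCoeff)⁻¹ * u i a) v w := by
  intro a b c j hj
  have hsum : ∑ i, C (D.trailingCoeff)⁻¹ * u i a * v i b * w i c =
      C (D.trailingCoeff)⁻¹ * (D * C (t a b c)) + C (D.trailingCoeff)⁻¹ * (D * X * C (r a b c)) := by
    rw [← mul_add, mul_assoc D X, ← mul_add, ← h a b c, Finset.mul_sum]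
    exact Finset.sum_congr rfl fun i _ => by ring
  have htc : D.trailingCoeff ≠ 0 := mt trailingCoeff_eq_zero.1 hD
  rw [hsum, coeff_add, coeff_C_mul, coeff_C_mul, coeff_mul_C, coeff_mul_C]
  rcases hj.lt_or_eq with hlt | rfl
  · rw [if_neg hlt.ne, coeff_eq_zero_of_lt_natTrailingDegree hlt]
    cases j with
    | zero => simp
    | succ j =>
      rw [coeff_mul_X, coeff_eq_zero_of_lt_natTrailingDegree (by omega)]
      simp
  · rw [if_pos rfl]
    have h0 : (D * X).coeff D.natTrailingDegree = 0 := by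
      cases hn : D.natTrailingDegree with
      | zero => simp
      | succ m => rw [coeff_mul_X, coeff_eq_zero_of_lt_natTrailingDegree (by omega)]
    rw [h0]
    change (D.trailingCoeff)⁻¹ * (D.trailingCoeff * t a b c) + _ = _
    rw [zero_mul, mul_zero, add_zero, ← mul_assoc, inv_mul_cancel₀ htc, one_mul]

/-- The `2 × 2` diagonal minors of the perturbed pencil `(T₁ + ε I, T₂ + ε diag(c))` are nonzero
polynomials as soon as `cᵢ ≠ cⱼ`: the `ε²`-coefficient of
`(s₁ + ε)(t₂ + ε c₂) - (s₂ + ε)(t₁ + ε c₁)` is `c₂ - c₁`. [folklore] -/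
theorem pert_minor_ne_zero (s₁ s₂ t₁ t₂ : F) {c₁ c₂ : F} (hc : c₁ ≠ c₂) :
    (C s₁ + X) * (C t₂ + X * C c₂) - (C s₂ + X) * (C t₁ + X * C c₁) ≠ 0 := by
  intro h0
  have e : (C s₁ + X) * (C t₂ + X * C c₂) - (C s₂ + X) * (C t₁ + X * C c₁) =
      C (s₁ * t₂ - s₂ * t₁) + C (s₁ * c₂ + t₂ - s₂ * c₁ - t₁) * X + C (c₂ - c₁) * X ^ 2 := by
    simp only [map_sub, map_add, map_mul]
    ring
  have h2 := congrArg (fun p : F[X] => p.coeff 2) e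
  simp only [h0, coeff_zero, coeff_add, coeff_C_mul, coeff_X_pow, coeff_C, coeff_X] at h2
  norm_num at h2
  exact hc (sub_eq_zero.1 h2.symm).symm

/-- **Every upper triangular `3 × 3` pencil is a degeneration of `⟨3⟩`, explicitly**: the cleared
eigen-decomposition (`exists_eigenmatrix`) of the perturbed pencil `(T₁ + ε I, T₂ + ε diag(c))` over
`F[ε]` (`c` three distinct scalars of the infinite field `F`) has a nonzero polynomial factor
`D = det A · det V`, whence an approximate decomposition with three triads of order `ord D`
(BCS Example (20.5)(2), made explicit). [cite: BurgisserClausenShokrollahi1997, Example (20.5)(2)] -/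
theorem exists_isApproxDecomposition_of_blockTriangular [Infinite F] {T₁ T₂ : Matrix (Fin 3) (Fin 3) F}
    (h₁ : T₁.BlockTriangular id) (h₂ : T₂.BlockTriangular id) :
    ∃ (h : ℕ) (u : Fin 3 → Fin 3 → F[X]) (v : Fin 3 → Fin 3 → F[X]) (w : Fin 3 → Fin 2 → F[X]),
      IsApproxDecomposition h (fun a b k => ![T₁ a b, T₂ a b] k) u v w := by
  classical
  -- three distinct scalars
  obtain ⟨e, he⟩ := Infinite.exists_notMem_finset ({0, 1} : Finset F)
  simp only [Finset.mem_insert, Finset.mem_singleton, not_or] at he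
  obtain ⟨c, hc⟩ : ∃ c : Fin 3 → F, c = ![0, 1, e] := ⟨_, rfl⟩
  have hc01 : c 0 ≠ c 1 := by simp [hc]
  have hc02 : c 0 ≠ c 2 := by simpa [hc] using fun h => he.1 h.symm
  have hc12 : c 1 ≠ c 2 := by simpa [hc] using fun h => he.2 h.symm
  -- the perturbed pencil over `F[ε]`
  obtain ⟨A, hA⟩ : ∃ A : Matrix (Fin 3) (Fin 3) F[X], A = T₁.map C + (X : F[X]) • 1 := ⟨_, rfl⟩
  obtain ⟨B, hB⟩ : ∃ B : Matrix (Fin 3) (Fin 3) F[X],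
      B = T₂.map C + (X : F[X]) • diagonal (fun i => C (c i)) := ⟨_, rfl⟩
  have hAij : ∀ i j, A i j = C (T₁ i j) + X * (if i = j then 1 else 0) := by
    intro i j; simp [hA, Matrix.one_apply]
  have hBij : ∀ i j, B i j = C (T₂ i j) + X * (if i = j then C (c i) else 0) := by
    intro i j; simp [hB, Matrix.diagonal_apply]
  obtain ⟨t10, t20, t21⟩ := (blockTriangular_iff₃ T₁).1 h₁
  obtain ⟨s10, s20, s21⟩ := (blockTriangular_iff₃ T₂).1 h₂
  have hAu : A.BlockTriangular id := (blockTriangular_iff₃ A).2 (by simp [hAij, t10, t20, t21])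
  have hBu : B.BlockTriangular id := (blockTriangular_iff₃ B).2 (by simp [hBij, s10, s20, s21])
  obtain ⟨T, hT⟩ : ∃ T, T = A.adjugate * B := ⟨_, rfl⟩
  obtain ⟨V, hVdet, hV₁, hV₂⟩ := exists_eigenmatrix hAu hBu
  rw [← hT] at hVdet hV₂
  -- the residual tensor (coefficient of `ε`)
  let r : Fin 3 → Fin 3 → Fin 2 → F :=
    fun a b k => ![if a = b then 1 else 0, if a = b then c a else 0] k
  have hD : A.det * V.det ≠ 0 := by
    obtain ⟨-, t00, t11, t22⟩ := adjugate_mul_of_blockTriangular hAu hBu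
    rw [← hT] at t00 t11 t22
    have e1 : T 1 1 - T 0 0 = A 2 2 * (A 0 0 * B 1 1 - A 1 1 * B 0 0) := by rw [t00, t11]; ring
    have e2 : T 2 2 - T 0 0 = A 1 1 * (A 0 0 * B 2 2 - A 2 2 * B 0 0) := by rw [t00, t22]; ring
    have e3 : T 2 2 - T 1 1 = A 0 0 * (A 1 1 * B 2 2 - A 2 2 * B 1 1) := by rw [t11, t22]; ring
    have hAd : ∀ i, A i i ≠ 0 := fun i => by
      rw [hAij, if_pos rfl, mul_one, add_comm]; exact X_add_C_ne_zero _
    have hm : ∀ i j, c i ≠ c j → A i i * B j j - A j j * B i i ≠ 0 := fun i j hij => by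
      rw [hAij, hAij, hBij, hBij, if_pos rfl, if_pos rfl, if_pos rfl, if_pos rfl, mul_one]
      exact pert_minor_ne_zero _ _ _ _ hij
    rw [Matrix.det_of_upperTriangular hAu, Fin.prod_univ_three, hVdet, e1, e2, e3]
    exact mul_ne_zero (mul_ne_zero (mul_ne_zero (hAd 0) (hAd 1)) (hAd 2))
      (mul_ne_zero (mul_ne_zero (hAd 2) (hm 0 1 hc01))
        (mul_ne_zero (mul_ne_zero (hAd 1) (hm 0 2 hc02)) (mul_ne_zero (hAd 0) (hm 1 2 hc12))))
  refine ⟨(A.det * V.det).natTrailingDegree, _, fun i b => V.adjugate i b,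
    fun i k => ![A.det, T i i] k,
    isApproxDecomposition_of_sum_eq_mul (t := fun a b k => ![T₁ a b, T₂ a b] k) (r := r)
      (u := fun i a => (A * V) a i) hD fun a b k => ?_⟩
  fin_cases k
  · simp only [Matrix.cons_val_zero, Fin.zero_eta]
    rw [hV₁ a b, hAij]
    simp only [r, Matrix.cons_val_zero]
    split_ifs <;> simp
  · simp only [Matrix.cons_val_one, Fin.mk_one, Matrix.cons_val_zero]
    rw [hV₂ a b, hBij]
    simp only [r, Matrix.cons_val_one, Matrix.cons_val_zero]
    split_ifs <;> simp

end PolyLayer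

/-! ## Every `3 × 3 × 2` tensor is a degeneration of `⟨3⟩` -/

section LemmaG

variable {F : Type*} [Field F]

/-- The 2-slice tensor of `(P T₁ Q, P T₂ Q)` is the restriction of that of `(T₁, T₂)` along
`(P, Qᵀ, 1)`. [folklore] -/
theorem pencil_factor_eq_sum (P Q T₁ T₂ : Matrix (Fin 3) (Fin 3) F) (x y : Fin 3) (z : Fin 2) :
    ![(P * T₁ * Q) x y, (P * T₂ * Q) x y] z =
      ∑ a, ∑ b, ∑ c, P x a * Q b y * (if c = z then 1 else 0) * ![T₁ a b, T₂ a b] c := by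
  have key : ∀ T : Matrix (Fin 3) (Fin 3) F,
      (P * T * Q) x y = ∑ a, ∑ b, P x a * Q b y * T a b := by
    intro T
    rw [Matrix.mul_apply]
    simp_rw [Matrix.mul_apply, Finset.sum_mul]
    rw [Finset.sum_comm]
    exact Finset.sum_congr rfl fun i _ => Finset.sum_congr rfl fun j _ => by ring
  simp only [Fin.sum_univ_two, Fin.isValue]
  fin_cases z <;> simp [key]

/-- **Every `3 × 3 × 2` tensor over an algebraically closed field is a degeneration of `⟨3⟩`**
(border rank `≤ 3`; BCS Example (20.5)(2) with Thm. (20.3): `R̲(3,3,2) = 3`), with an explicit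
degeneration: triangularise the pencil by equivalence (`exists_blockTriangular_factor`), take the
cleared eigen-decomposition of its perturbation (`exists_isApproxDecomposition_of_blockTriangular`)
and transport it back. [cite: BurgisserClausenShokrollahi1997, Example (20.5)(2)] -/
theorem algDegeneratesTo_unitTensor_pencil [IsAlgClosed F] (M₁ M₂ : Matrix (Fin 3) (Fin 3) F) :
    AlgDegeneratesTo (unitTensor F 3) (fun a b k => ![M₁ a b, M₂ a b] k) := by
  obtain ⟨P, Q, T₁, T₂, hT₁, hT₂, rfl, rfl⟩ := exists_blockTriangular_factor M₁ M₂
  obtain ⟨h, u, v, w, hd⟩ := exists_isApproxDecomposition_of_blockTriangular hT₁ hT₂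
  exact ⟨h, _, _, _, hd.isApproxRestriction_unitTensor.eq_sum_comp
    (A₁ := fun x a => P x a) (B₁ := fun y b => Q b y) (C₁ := fun z c => if c = z then (1 : F) else 0)
    (pencil_factor_eq_sum P Q T₁ T₂)⟩

end LemmaG

end MatrixPencil

end Literature.Computability.AlgebraicComplexity

end
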